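import Summits.AnomalousDissipation.AnomalousDissipation.Theorems.SolenoidalFractalHomogenisationLagrangianStepCellLawVSectorExact
import Summits.AnomalousDissipation.AnomalousDissipation.Theorems.SolenoidalFractalHomogenisationLagrangianStepCellLawVOddGainDefectSecondOrderDesign
import HarnessLib

/-!
# K1L `LagrangianRenormalisationStep(Design)` (K1L_D, stmt-AnomalousDissipation-27980; aside 24912), stub `stub_cellLawV0_IS`
# — the odd half of the quasi-static W5 window with EXACT sector non-expansion: `κ = c·√5/3` from the window box ratio alone
# (helper; `--supports stmt-AnomalousDissipation-27980`)

Summits-side helper file of route `SolenoidalFractalHomogenisation` (prover seat `ad-k1l-cellLawV-w1` g2), on top of `…CellLawVSectorExact`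
(`sector_form_qsResp_exact`) and `…CellLawVOddGainDefectSecondOrderDesign` (`lowerEdge_second_order_closed`).  With the response sector equal to
the block sector (`τ' = τ`), the per-slot hypotheses of `oddSectorial_excQS_strict` (p650822) reduce to the transverse WINDOW alone:
* **`oddSectorial_excQS_exact`** — for `W₀` (`ρ₀ = W₀.ramp`, `ϑ_∞ = 1 − 4ρ₀/3`), `0 < lo ≤ 1 ≤ hi`, `τ ≥ 0`, box `[y, c·y]`, `T₀ > 0` below the slot
  relaxations, `m₂ = (ϑ_∞ − 2/(ρ₀(T₀hi)²))/hi − (τhi)²ϑ_∞/(4lo³)`: `y ≤ m₂` and `ϑ_∞/lo ≤ c·y` give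
  `NearIso S lo hi ∧ OddSectorial S τ → OddSectorial (excQS W₀ M S) ((c√5/3)·τ)`;
* **`oddSectorial_excQS_contraction_exact`** — for every `τ ∈ [0, τ₀]`: `OddSectorial (excQS W₀ M S) (κ·τ)` with
  `κ = (ϑ_∞/(lo·m₂(τ₀)))·(√5/3)` — `κ → (√5/3)·hi/lo = 0.745·ΛV²` (`T₀ → ∞`, `τ₀ → 0`) for the window `[1/ΛV, ΛV]`; e.g. `ΛV = 1.05`, `T₀ = 30`,
  `τ₀ = 0.3` gives `κ ≈ 0.86` (the tenure sheet's `ΛV := 1.05` is admissible; compare `oddSectorial_excQS_contraction`, `κ ≈ 0.745·ΛV⁶`).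
Everything PROVED, no definition, no named fact, no sorry.  Infrastructure for route-1's rung leaf F-D1.A0 (frontier FORMAL rung); NOT a proof of the
stub, of the crux, of Onsager's conjecture or of anomalous dissipation.  Prover seat `ad-k1l-cellLawV-w1` g2, 2026-08-28.
-/

set_option linter.dupNamespace false

noncomputable section

namespace Summit.AnomalousDissipation.AnomalousDissipation.Theorems.SolenoidalFractalHomogenisation.LagrangianStep.OddGain

open Matrix Finset MeasureTheory Set
open Literature.Analysis Literature.Analysis.FunctionSpaces Literature.Analysis.FluidPDE
open Literature.Analysis.FluidPDE.LatticeShear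

/-! ## §18 The odd half with exact non-expansion -/

section ExactDesign

/-- **THE ODD HALF OF THE QUASI-STATIC W5 WINDOW, EXACT SECTOR**: for `W₀`, `0 < lo ≤ 1 ≤ hi`, `τ ≥ 0`, box `[y, c·y]` (`y, c ≥ 0`), `T₀ > 0`
below the slot relaxations, the two NUMERICAL inequalities `y ≤ (ϑ_∞ − 2/(ρ₀(T₀hi)²))/hi − (τhi)²ϑ_∞/(4lo³)` and `ϑ_∞/lo ≤ c·y` give
`NearIso S lo hi ∧ OddSectorial S τ ⇒ OddSectorial (excQS W₀ M S) ((c√5/3)·τ)` — the response sector is the block sector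
(`sector_form_qsResp_exact`). [folklore] -/
theorem oddSectorial_excQS_exact (Mlag : ℝ) {lo hi τ y c T₀ : ℝ} (hlo : 0 < lo) (hlo1 : lo ≤ 1) (hhi1 : 1 ≤ hi)
    (hy : 0 ≤ y) (hc : 0 ≤ c) (hτ : 0 ≤ τ) (hT₀ : 0 < T₀)
    (hTs : ∀ s : Fin 26, T₀ ≤ 4 * Real.pi ^ 2 * ‖Torus.latticeVec (cubatureWord.phase s).m‖ ^ 2 * Mlag * (cubatureWord.phase s).τ)
    (h1 : y ≤ (1 - 4 * cubatureWord.ramp / 3 - 2 / (cubatureWord.ramp * (T₀ * hi) ^ 2)) / hi -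
      (τ * hi) ^ 2 * (1 - 4 * cubatureWord.ramp / 3) / (4 * lo ^ 3))
    (h2 : (1 - 4 * cubatureWord.ramp / 3) / lo ≤ c * y)
    {S : Torus.Visc4 (Fin 3)} (hS : Torus.NearIso S lo hi) (hodd : OddSectorial S τ) :
    OddSectorial (excQS cubatureWord Mlag S) (c * Real.sqrt 5 / 3 * τ) := by
  have hρ := cubatureWord.ramp_pos
  have hρ2 := cubatureWord.ramp_le
  have hhi : 0 < hi := by linarith
  have hform : ∀ s (x z : Fin 3 → ℝ), x ⬝ᵥ (slotQ cubatureWord Mlag S s) *ᵥ z =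
      ((projPerp (slotN s)) *ᵥ x) ⬝ᵥ (qsResp cubatureWord.ramp (4 * Real.pi ^ 2 * ‖Torus.latticeVec (cubatureWord.phase s).m‖ ^ 2 *
        Mlag * (cubatureWord.phase s).τ) (regBlock S (slotN s))) *ᵥ ((projPerp (slotN s)) *ᵥ z) := by
    intro s x z
    rw [← sum_sum_eq_form, slotQ_form_eq, slotN]
  have hsecB : ∀ s : Fin 26, ∀ x z : Fin 3 → ℝ, (x ⬝ᵥ (regBlock S (slotN s)) *ᵥ z - z ⬝ᵥ (regBlock S (slotN s)) *ᵥ x) ^ 2 ≤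
      τ ^ 2 * ((x ⬝ᵥ (regBlock S (slotN s)) *ᵥ x) * (z ⬝ᵥ (regBlock S (slotN s)) *ᵥ z)) :=
    fun s => sectorForm_regBlock (sum_mhat_sq _) hS hlo.le hodd
  have hwinB : ∀ s : Fin 26, ∀ x : Fin 3 → ℝ, lo * (x ⬝ᵥ x) ≤ x ⬝ᵥ (regBlock S (slotN s)) *ᵥ x ∧
      x ⬝ᵥ (regBlock S (slotN s)) *ᵥ x ≤ hi * (x ⬝ᵥ x) :=
    fun s => window_regBlock (sum_mhat_sq _) hS hlo1 hhi1
  have hpsdB : ∀ s : Fin 26, ∀ x : Fin 3 → ℝ, 0 ≤ x ⬝ᵥ (regBlock S (slotN s)) *ᵥ x := fun s x =>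
    (mul_nonneg hlo.le (by rw [self_dotProduct_eq_sum_sq]; exact Finset.sum_nonneg fun i _ => sq_nonneg _)).trans (hwinB s x).1
  refine oddSectorial_excQS_strict Mlag S hy hc hτ (fun s x z => ?_) (fun s x => ?_)
  · have hT := hTs s
    have hTpos := hT₀.trans_le hT
    rw [hform, hform, hform, hform]
    exact sector_form_qsResp_exact hTpos.le hτ (hpsdB s) (hsecB s) _ _
  · have hT := hTs s
    have hTpos := hT₀.trans_le hT
    have hn : ∑ a, slotN s a ^ 2 = 1 := by rw [← self_dotProduct_eq_sum_sq]; exact slotN_unit s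
    have hQ : 0 ≤ ((projPerp (slotN s)) *ᵥ x) ⬝ᵥ ((projPerp (slotN s)) *ᵥ x) := by
      rw [self_dotProduct_eq_sum_sq]; exact Finset.sum_nonneg fun i _ => sq_nonneg _
    rw [hform, ← perpSq_eq_projPerp (slotN s) x hn]
    constructor
    · exact (mul_le_mul_of_nonneg_right h1 hQ).trans (lowerEdge_second_order_closed hρ hρ2 hT₀ hT hτ hlo hhi (hsecB s) (hwinB s) _)
    · calc _ ≤ qsRespScalar cubatureWord.ramp _ lo * (((projPerp (slotN s)) *ᵥ x) ⬝ᵥ ((projPerp (slotN s)) *ᵥ x)) :=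
            qsResp_window_upper hTpos.le (fun x => (hwinB s x).1) _
        _ ≤ (1 - 4 * cubatureWord.ramp / 3) / lo * (((projPerp (slotN s)) *ᵥ x) ⬝ᵥ ((projPerp (slotN s)) *ᵥ x)) :=
            mul_le_mul_of_nonneg_right (qsRespScalar_le hρ hρ2 hTpos.le hlo) hQ
        _ ≤ c * y * (((projPerp (slotN s)) *ᵥ x) ⬝ᵥ ((projPerp (slotN s)) *ᵥ x)) := mul_le_mul_of_nonneg_right h2 hQ

/-- **THE QUASI-STATIC EXCESS CONTRACTS THE KATO SECTOR — exact gain `κ = (ϑ_∞/(lo·m₂))·√5/3`.**  For `W₀`, a window `0 < lo ≤ 1 ≤ hi`, a maximal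
half-angle `τ₀`, `T₀ > 0` below the slot relaxations and `m₂ := (ϑ_∞ − 2/(ρ₀(T₀hi)²))/hi − (τ₀hi)²ϑ_∞/(4lo³) > 0`: for EVERY `τ ∈ [0, τ₀]` and every
`S` with `NearIso S lo hi`, `OddSectorial S τ`: `OddSectorial (excQS W₀ M S) (κ·τ)`.  For the window `[1/ΛV, ΛV]`: `κ → 0.745·ΛV²`
(`T₀ → ∞`, `τ₀ → 0`); `ΛV = 1.05`, `T₀ = 30`, `τ₀ = 0.3` ⇒ `κ ≈ 0.86`. [folklore] -/
theorem oddSectorial_excQS_contraction_exact (Mlag : ℝ) {lo hi τ₀ T₀ : ℝ} (hlo : 0 < lo) (hlo1 : lo ≤ 1) (hhi1 : 1 ≤ hi)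
    (hT₀ : 0 < T₀)
    (hTs : ∀ s : Fin 26, T₀ ≤ 4 * Real.pi ^ 2 * ‖Torus.latticeVec (cubatureWord.phase s).m‖ ^ 2 * Mlag * (cubatureWord.phase s).τ)
    (hm : 0 < (1 - 4 * cubatureWord.ramp / 3 - 2 / (cubatureWord.ramp * (T₀ * hi) ^ 2)) / hi -
      (τ₀ * hi) ^ 2 * (1 - 4 * cubatureWord.ramp / 3) / (4 * lo ^ 3))
    {τ : ℝ} (hτ : τ ∈ Set.Icc 0 τ₀) {S : Torus.Visc4 (Fin 3)} (hS : Torus.NearIso S lo hi) (hodd : OddSectorial S τ) :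
    OddSectorial (excQS cubatureWord Mlag S)
      ((1 - 4 * cubatureWord.ramp / 3) / (lo * ((1 - 4 * cubatureWord.ramp / 3 - 2 / (cubatureWord.ramp * (T₀ * hi) ^ 2)) / hi -
          (τ₀ * hi) ^ 2 * (1 - 4 * cubatureWord.ramp / 3) / (4 * lo ^ 3))) * Real.sqrt 5 / 3 * τ) := by
  set ϑ := 1 - 4 * cubatureWord.ramp / 3 with hϑ
  set y := (ϑ - 2 / (cubatureWord.ramp * (T₀ * hi) ^ 2)) / hi - (τ₀ * hi) ^ 2 * ϑ / (4 * lo ^ 3) with hydef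
  have hρ2 := cubatureWord.ramp_le
  have hϑ0 : 0 < ϑ := by rw [hϑ]; linarith
  have hhi : 0 < hi := by linarith
  have hy : 0 < y := hm
  have hτ0 : 0 ≤ τ := hτ.1
  have hmono : y ≤ (ϑ - 2 / (cubatureWord.ramp * (T₀ * hi) ^ 2)) / hi - (τ * hi) ^ 2 * ϑ / (4 * lo ^ 3) := by
    have hsq : (τ * hi) ^ 2 ≤ (τ₀ * hi) ^ 2 := pow_le_pow_left₀ (by positivity) (mul_le_mul_of_nonneg_right hτ.2 hhi.le) 2
    have : (τ * hi) ^ 2 * ϑ / (4 * lo ^ 3) ≤ (τ₀ * hi) ^ 2 * ϑ / (4 * lo ^ 3) :=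
      div_le_div_of_nonneg_right (mul_le_mul_of_nonneg_right hsq hϑ0.le) (by positivity)
    rw [hydef]; linarith
  have hc : 0 ≤ ϑ / (lo * y) := by positivity
  have h2 : (1 - 4 * cubatureWord.ramp / 3) / lo ≤ ϑ / (lo * y) * y := by
    rw [← hϑ]
    exact le_of_eq (by field_simp)
  exact oddSectorial_excQS_exact Mlag hlo hlo1 hhi1 hy.le hc hτ0 hT₀ hTs hmono h2 hS hodd

end ExactDesign

end Summit.AnomalousDissipation.AnomalousDissipation.Theorems.SolenoidalFractalHomogenisation.LagrangianStep.OddGain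

end
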